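/-
ι₁ ∕ Id CHAIN — row I10 (ASSEMBLER d2bridge-plan g3, MODULE TABLE `HOME/d2bridge/iota1/TABLE.md`; coordinator ruling «WORLD = C FINAL»,
pub-hodgecm2/INBOX l.12654): the §A bridge theorem ✔ `D2Bridge/Thm418CAtPin.lean` (`thm418C_atPin`, p372563, d2bridge-prove-1) RE-TYPED over the
UNTWISTED honest Prop-C.5 datum `Model.honestP5IdOf` ∕ `Model.sec42DataIdOf` (I0 ∕ I1, instlevel-a), its Hecke translates
`Model.heckeTranslatesFamilyIdOf` (I2, instlevel-b), the μ-uniform carriers `Model.uniformOmegaRepId` with their `rfl` transport lemmas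
(I3, cmside-a) and the engine chain `…thm418C_liuDictionaryPin_of_pinsId` (I7b, d2bridge-prove-2).  Pen prover-pub-hodgecm2-d2bridge-wb-3-g4-0
(from d2bridge-wb-4's draft a05d49d53cee; «b» = wb-4); generated from a notation source by prove-1's `expand_notation → shorten → reflow`, so the
file carries NO notation.  ONE theorem, kernel lane, explicit binders; no definition, no named fact, no `sorry`; nothing landed is edited or
restated.  HC_CM is NOT proved; «Δ2 BRIDGE CLOSED» is NOT claimed; hLiu = READING r8; HELD.
-/
import Summits.HodgeConjecture.CorCM.D2Bridge.Iota1.PinSignatures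
import Summits.HodgeConjecture.CorCM.D2Bridge.Iota1.UniformOmegaRep
import Summits.HodgeConjecture.CorCM.B01.Transposition.HComp.Sec42DataIdOf
import Summits.HodgeConjecture.CorCM.B01.Transposition.HComp.HeckeTranslatesIdOf
import Summits.HodgeConjecture.CorCM.D2Bridge.OmegaAtDeltaPrimeLine
import Summits.HodgeConjecture.CorCM.D2Bridge.OmegaPinAtLiuIndexOfRecord
import Summits.HodgeConjecture.CorCM.B01.Transposition.Item6PinBlockVanishing
import Summits.HodgeConjecture.CorCM.B01.Transposition.Item6CentralTypeAtPinSmooth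
import Summits.HodgeConjecture.CorCM.B01.Transposition.Item6UniformOmegaRep
import Summits.HodgeConjecture.HodgeCM.Model.LiuIndexCentralType_1
import Summits.HodgeConjecture.HodgeCM.Model.LiuIndexMuLiu
import Summits.HodgeConjecture.HodgeCM.Model.LiuDictionaryPinEq
import Summits.HodgeConjecture.HodgeCM.Model.AdelicThetaDistributionSat_1
import Summits.HodgeConjecture.CorCM.Model.CMAbelianVarietyEigenbasisRealisedHolds
import Summits.HodgeConjecture.CorCM.Geometry.BallQuotientUniformisedHolds
import Literature.AlgebraicGeometry.HodgeTheory.ComplexConjugationHolds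
import Literature.AlgebraicGeometry.HodgeTheory.HodgeFiltrationModelsReductionProofs
import Literature.NumberTheory.Transcendental.AnalytificationMorphismsProofs
import Literature.NumberTheory.Automorphic.Liu2021.AppendixC.UniformOmegaCiteLegs
import Literature.NumberTheory.GelbartRogawski1991.UnitaryDualPairThetaKernelCMKTypeFin
import HarnessLib

/-!
# Δ2 bridge — the bridge theorem at the literal pin OVER THE UNTWISTED DATUM (`Iota1.Thm418CAtPin`)

[Liu2021] Y. Liu, *Fourier–Jacobi cycles and arithmetic relative trace formula*, Camb. J. Math. **9** (2021) = arXiv:2102.11518.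

ONE theorem, kernel lane: `Iota1.Thm418CAtPin.thm418C_atPinId` = ONE application of `PinSignatures.thm418C_liuDictionaryPin_of_pinsId`
(`Iota1/PinSignatures.lean`) at the index of record `I := LiuIndex.I V (repAt a₀) (muLiu ι₁ GramClass.rep)`, `line := LiuIndex.line V …`, at the
record rows, with the App-C standing datum of the whole §A read at the UNTWISTED datum `ℭ₁ := Model.sec42DataIdOf h isoOf F ι₁ V Φ`
(`X_K := M_K`, slot `(τ₁, ι₁)`; under «WORLD = C» the datum whose cofan along `ι₁` — hence `ComponentAlbanese` at instance `ι₁` — exists).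
Binder shapes = those of ✔ `Thm418CAtPin.thm418C_atPin` (p372563) with EVERY displayed object over `ℭ₁`:

* DISPLAYED CITES (group (a)): `hLiu` [Thm 4.18] AS PRINTED (a READING r8), `h411R` [Def 4.11] and `hD1` [App. D Lem. D.1 (1)] at the
  rests `(𝕌₁ i).rest 𝔱₁` — `𝕌₁ i := Model.uniformOmegaRepId … (2 * imagUnit F)⁻¹ (fun _ _ => repOfLine a_i)` (the μ-uniform Weil carriers of
  record, δ′ = (2δ_F)⁻¹, by field transport from ✔ `Model.uniformOmegaRep`), `𝔱₁ := restTailOne (AlgHom.id ℚ F) ι₁ hμ hw (ofPolDR …)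
  ((Model.heckeTranslatesFamilyIdOf …).rhoΩOne …)` — which IS `restOne ℭ₁ (AlgHom.id ℚ F) ι₁ hμ hw …` (`UniformOmega.restOne_eq_rest`, `rfl`):
  Liu's printed objects of Def. 4.5 (2) ∕ 4.11 ∕ 4.16 over the untwisted datum (no `restOfCharDeltaPrime` twin is needed or used in a display);
  `h413` [Prop 4.13] AS PRINTED and the cross-`μ` leg `hμsep` over `(𝕌₁ i).prop413Data 𝔇.H` (= the twisted one by `rfl`,
  `Model.prop413Data_uniformOmegaRepId_eq`).
* BY VALUE inside the proof: (b) the Ω-pin at the index of record — prove-7's ✔ `LiuIndex.OmegaPin.exists_pinTerms_indexOfRecord` at the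
  TWISTED uniform rests `(𝕌₀ i).rest 𝔱₀` (seam ✔ `Model.restOfCharRep_eq_rest`), whose `σ ∕ e ∕ hσ ∕ he` are carried to the rests over `ℭ₁`
  line by line by cmside-a's generic-tail transport `Model.exists_omegaPin_transport_uniformOmegaRepId` (I3: `AdmIndex ∕ omegaAt ∕ rhoAt` of
  `(ℭ₁, 𝕌₁, t₁)` and `(ℭ, 𝕌, t)` agree by `rfl` for arbitrary tails); `hnvD` [Lem D.1 (1) ⇒ ω ≠ 0] — F4's
  ✔ `nontrivial_omegaAt_restOfCharDeltaPrime_of_lemD1AsPrinted` at the twisted rest from the DISPLAYED `hD1`, carried over by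
  `Model.nontrivial_omegaAt_transport_uniformOmegaRepId`; block vanishing off the continuous lines (✔ `block_pin_lineOf_eq_bot_of_not_smooth`
  + ✔ `continuous_of_hasCentralTypeAt_of_smooth`); `h411 ∕ hsep` DERIVED (✔ `UniformOmegaCiteLegs`); `Ks := Level.capThree ℭ₁.S.K₀`, `hK`.
* BY NAME (the residual of record in `PinSignatures`' abstract currency, for every index line and every weight-one conjugate-symplectic `μ`,
  typed over `ℭ₁ ∕ 𝕌₁ ∕ 𝔱₁`): the J-record ∕ pieces families `M ∕ jH ∕ hjHinj ∕ hjH ∕ pieces` — inhabited BY VALUE over `ℭ₁` by rows I5–I8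
  (`Iota1.ComponentAlbanesePin`, `Iota1.HcmPiecesAtPin`, `Iota1/R3`), which the edition-3 END plugs in.
Conclusion = `(liuDictionaryPin …).Thm418C` at `(F, ι₁, V, a₀)`, VERBATIM the `h418` binder body of ✔ `PortJoin.hc_cm_of_thm418C_local`.
HC_CM is NOT proved here; «Δ2 BRIDGE CLOSED» is NOT claimed; `hLiu` is a READING (r8) of [Liu2021, Thm. 4.18] at the constructed objects.

References: [Liu2021] Thm. 4.18 (p. 52), Prop. 4.13 (p. 47), Def. 4.11 (p. 46), Def. 4.12, Def. 4.5 (2) (p. 42), Lem. 2.4 (1) (p. 23),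
App. D Lem. D.1 (1),(3) (pp. 125–126); [GelbartRogawski1991] §3.1 Prop. 3.1.1; [Shimura1998] Thm. 21.4.
-/

set_option autoImplicit false

noncomputable section

open scoped TensorProduct Matrix

namespace Summit.HodgeConjecture.CorCM.D2Bridge.Iota1.Thm418CAtPin

open NumberField NumberField.InfinitePlace IsDedekindDomain
open HodgeCM.Model HodgeCM.Model.LiuIndex HodgeCM.Model.TowerCarrier
open HodgeCM.Literature.Theta.LiuAlbaneseModuleDatum.D2Bridge (HcmPieces)
open Summit.HodgeConjecture.CorCM.Model Summit.HodgeConjecture.CorCM.Transposition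
open Literature.AlgebraicGeometry.Motives (CMType)
open Literature.AlgebraicGeometry.HodgeTheory Literature.NumberTheory.Automorphic.PicardCM
open Literature.AlgebraicGeometry.ShimuraVarieties.UnitaryCanonicalModel
open Literature.NumberTheory.Automorphic
open Literature.NumberTheory.Automorphic.IdeleClassGroup (toHeckeCharacter isUnitary_toHeckeCharacter)
open Literature.NumberTheory.Automorphic.Liu2021 Literature.NumberTheory.Automorphic.Liu2021.AppendixC
open Literature.NumberTheory.Automorphic.Liu2021.AppendixC.RestOne
open Literature.NumberTheory.Automorphic.Liu2021.Def411WeilCarriers (locF Rep)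
open Literature.NumberTheory.GelbartRogawski1991 Literature.NumberTheory.GelbartRogawski1991.UnitaryDualPair
open Literature.NumberTheory.GelbartRogawski1991.UnitaryDualPair.LocalSplitting (localMu norm_localMu continuous_localMu
  localMu_toLocalRing_eq_one_iff)
open Literature.RepresentationTheory Literature.RepresentationTheory.Liu2021
open Summit.HodgeConjecture.CorCM.Transposition.OmegaTransport (realUnit)
open HodgeCM.Model.ArchSideTerm (e₁)

/-! ## The bridge theorem at the literal pin -/

set_option synthInstance.maxHeartbeats 400000 in
set_option maxHeartbeats 6400000 in
/-- **THE BRIDGE THEOREM AT THE LITERAL PIN, OVER THE UNTWISTED DATUM** (ι₁∕Id chain row I10; the Id twin of ✔ `Thm418CAtPin.thm418C_atPin`).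
From the printed citations at the CONSTRUCTED objects over `ℭ₁ := Model.sec42DataIdOf …` — per index line `i` and every conjugate-symplectic
weight-one `μ`: `hLiu` [Liu21, Thm. 4.18] AS PRINTED at the rest `(𝕌₁ i).rest 𝔱₁` (= `restOne ℭ₁ …` by `rfl`; a READING r8), `h411R` [Def. 4.11]
and `hD1` [App. D Lem. D.1 (1)] there, `h413` [Prop. 4.13] AS PRINTED at the tower, `hμsep` (the cross-`μ` leg of [Lem. D.1 (3)]) — and the
residual of record BY NAME over `ℭ₁ ∕ 𝕌₁ ∕ 𝔱₁`: (c) `M ∕ jH ∕ hjHinj ∕ hjH`, (d) `pieces` (inhabited by value by rows I5–I8 of the chain).  BY VALUE: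
group (a) (uniform carriers `Model.uniformOmegaRepId`, tails, rests, `hnvD` — F4 at the twisted rest carried over by
`Model.nontrivial_omegaAt_transport_uniformOmegaRepId` —, `h411`, `hsep`, `Ks`, `hK`), group (b) (the Ω-pin at the index of record: the lines'
weight-one characters `μ_i`, and `σ ∕ hσ ∕ e ∕ he` from ✔ `OmegaPin.exists_pinTerms_indexOfRecord` at the twisted rests carried over by
`Model.exists_omegaPin_transport_uniformOmegaRepId`) and block vanishing off the continuous lines (`block_pin_lineOf_eq_bot_of_not_smooth` +
`continuous_of_hasCentralTypeAt_of_smooth`).  Conclusion = the reading r8 `Thm418C` of the pinned dictionary of record at `(F, ι₁, V, a₀)`, VERBATIM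
the `h418` binder body of `PortJoin.hc_cm_of_thm418C_local`.  HC_CM is NOT proved here; NOT «Δ2 BRIDGE CLOSED».
[cite: Liu2021, Thm. 4.18 (FJcycle.tex l. 2232–2245); Prop. 4.13 (l. 2113–2119); Def. 4.11 (l. 2083–2097); App. D Lem. D.1 (1),(3) (l. 5226–5233)]
[cite: GelbartRogawski1991, §3.1 Prop. 3.1.1 p. 455 L1–3] -/
theorem thm418C_atPinId (F : HodgeCM.CMField) [IsGalois ℚ (F : Type)] (h6 : 6 ≤ Module.finrank ℚ (F : Type))
    {ι₁ : (F : Type) →+* ℂ} (V : HodgeCM.HermSpace3 F ι₁) (hV : (InfinitePlace.mk ι₁).embedding = ι₁) (a₀ : RealScalar F)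
    (h : exists_recordSystem) (Φ : CMType (F : Type))
    -- [Liu2021, Thm. 4.18] AS PRINTED at the rests `(𝕌₁ i).rest 𝔱₁` over the untwisted datum — a READING r8 at the constructed objects
    (hLiu : ∀ (i : (I V (repAt a₀) (muLiu ι₁ GramClass.rep))) (μ : Literature.NumberTheory.Automorphic.IdeleClassGroup (F : Type) →ₜ* Circle)
      (hμ : IdeleClassGroup.IsConjugateSymplectic (F : Type) μ) (hw : IdeleClassGroup.HasWeight (F : Type) μ 1),
      Thm418AsPrinted (toThm418Data _ (((uniformOmegaRepId h ⟨F.K⟩ ι₁ (⟨V.Hm, V.isHermitian, V.signature_ι₁, V.posDef_of_ne⟩) Φ e₁ (frameD V) (frameD_real V) (frameD_ne V) (ιVE V) (2 *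
            imagUnit (HodgeCM.CMField.K F))⁻¹ (fun _ _ => (repOfLine ⟨F.K⟩ (repAt a₀ (Sigma.fst i)).1 (repAt a₀ (Sigma.fst i)).2.1 (repAt a₀ (Sigma.fst i)).2.2)))).rest (restTailOne
            (AlgHom.id ℚ _) ι₁ hμ hw (Def45.Carriers.ofPolDR μ (Def45.PolDR ι₁ hμ (Def45.RMuForm ι₁ hμ))) ((heckeTranslatesFamilyIdOf heckeTranslate_definedOver_holds h isoOf ⟨F.K⟩ ι₁
            (⟨V.Hm, V.isHermitian, V.signature_ι₁, V.posDef_of_ne⟩) Φ h6).rhoΩOne (AlgHom.id ℚ _) ι₁ hμ hw (Def45.Carriers.ofPolDR μ (Def45.PolDR ι₁ hμ (Def45.RMuForm ι₁ hμ))))))))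
    -- [Liu2021, Def. 4.11] AS PRINTED at those rests
    (h411R : ∀ (i : (I V (repAt a₀) (muLiu ι₁ GramClass.rep))) (μ : Literature.NumberTheory.Automorphic.IdeleClassGroup (F : Type) →ₜ* Circle)
      (hμ : IdeleClassGroup.IsConjugateSymplectic (F : Type) μ) (hw : IdeleClassGroup.HasWeight (F : Type) μ 1),
      Def411AsPrinted (toThm418Data _ (((uniformOmegaRepId h ⟨F.K⟩ ι₁ (⟨V.Hm, V.isHermitian, V.signature_ι₁, V.posDef_of_ne⟩) Φ e₁ (frameD V) (frameD_real V) (frameD_ne V) (ιVE V) (2 *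
            imagUnit (HodgeCM.CMField.K F))⁻¹ (fun _ _ => (repOfLine ⟨F.K⟩ (repAt a₀ (Sigma.fst i)).1 (repAt a₀ (Sigma.fst i)).2.1 (repAt a₀ (Sigma.fst i)).2.2)))).rest (restTailOne
            (AlgHom.id ℚ _) ι₁ hμ hw (Def45.Carriers.ofPolDR μ (Def45.PolDR ι₁ hμ (Def45.RMuForm ι₁ hμ))) ((heckeTranslatesFamilyIdOf heckeTranslate_definedOver_holds h isoOf ⟨F.K⟩ ι₁
            (⟨V.Hm, V.isHermitian, V.signature_ι₁, V.posDef_of_ne⟩) Φ h6).rhoΩOne (AlgHom.id ℚ _) ι₁ hμ hw (Def45.Carriers.ofPolDR μ (Def45.PolDR ι₁ hμ (Def45.RMuForm ι₁ hμ))))))))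
    -- [Liu2021, App. D Lem. D.1 (1)] AS PRINTED at every finite place of the local data of those rests
    (hD1 : ∀ (i : (I V (repAt a₀) (muLiu ι₁ GramClass.rep))) (μ : Literature.NumberTheory.Automorphic.IdeleClassGroup (F : Type) →ₜ* Circle)
      (hμ : IdeleClassGroup.IsConjugateSymplectic (F : Type) μ) (hw : IdeleClassGroup.HasWeight (F : Type) μ 1)
      (j : (toThm418Data _ (((uniformOmegaRepId h ⟨F.K⟩ ι₁ (⟨V.Hm, V.isHermitian, V.signature_ι₁, V.posDef_of_ne⟩) Φ e₁ (frameD V) (frameD_real V) (frameD_ne V) (ιVE V) (2 * imagUnit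
            (HodgeCM.CMField.K F))⁻¹ (fun _ _ => (repOfLine ⟨F.K⟩ (repAt a₀ (Sigma.fst i)).1 (repAt a₀ (Sigma.fst i)).2.1 (repAt a₀ (Sigma.fst i)).2.2)))).rest (restTailOne (AlgHom.id
            ℚ _) ι₁ hμ hw (Def45.Carriers.ofPolDR μ (Def45.PolDR ι₁ hμ (Def45.RMuForm ι₁ hμ))) ((heckeTranslatesFamilyIdOf heckeTranslate_definedOver_holds h isoOf ⟨F.K⟩ ι₁ (⟨V.Hm,
            V.isHermitian, V.signature_ι₁, V.posDef_of_ne⟩) Φ h6).rhoΩOne (AlgHom.id ℚ _) ι₁ hμ hw (Def45.Carriers.ofPolDR μ (Def45.PolDR ι₁ hμ (Def45.RMuForm ι₁ hμ))))))).AdmIndex) (v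
            : HeightOneSpectrum (𝓞 ↥(maximalRealSubfield (F : Type)))),
      LemD1_1AsPrinted
      (Def411WeilCarriers.localLemD1Data ↥(maximalRealSubfield (F : Type)) (F : Type) (IsCMField.complexConj (F : Type)) 3 e₁
        (Matrix.diagonal (frameD V)) (complexConj_imagUnit (F : Type)) (imagUnit_ne_zero (F : Type)) (imagUnit_mul_self (F : Type))
        (realDiagonal_isSymm (F : Type) (frameD V) (frameD_real V)) (isUnit_det_realDiagonal (F : Type) (frameD V) (frameD_real V) (frameD_ne V))
        (realDiagonal_map (F : Type) (frameD V) (frameD_real V)).symm (((repOfLine ⟨F.K⟩ (repAt a₀ (Sigma.fst i)).1 (repAt a₀ (Sigma.fst i)).2.1 (repAt a₀ (Sigma.fst i)).2.2)).toFun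
              j.1.1)
        (OmegaChiSplitting.chiLocalSplittingsD ⟨F.K⟩ e₁ (frameD V) (frameD_real V) (frameD_ne V) (toHeckeCharacter (F : Type) μ)
          ((isOscillatorChar_toHeckeCharacter_iff μ).mpr hμ) (((repOfLine ⟨F.K⟩ (repAt a₀ (Sigma.fst i)).1 (repAt a₀ (Sigma.fst i)).2.1 (repAt a₀ (Sigma.fst i)).2.2)).toFun j.1.1))
        (le_refl 3) (localMu (F : Type) (toHeckeCharacter (F : Type) μ))
        (fun v x => norm_localMu (F : Type) (toHeckeCharacter (F : Type) μ) v (isUnitary_toHeckeCharacter (F : Type) μ) x)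
        (continuous_localMu (F : Type) (toHeckeCharacter (F : Type) μ))
        (fun v t => localMu_toLocalRing_eq_one_iff (F : Type) (toHeckeCharacter (F : Type) μ) v ((isOscillatorChar_toHeckeCharacter_iff μ).mpr hμ) t)
        j.1.2.1
        (Def411WeilCarriers.norm_chi_eq_one ↥(maximalRealSubfield (F : Type)) (F : Type) (IsCMField.complexConj (F : Type))
          (Algebra.IsQuadraticExtension.finrank_eq_two ↥(maximalRealSubfield (F : Type)) (F : Type))
          (UnitaryGroup.algEquiv_ne_one_of_apply_eq_neg ↥(maximalRealSubfield (F : Type)) (F : Type) (IsCMField.complexConj (F : Type))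
            (complexConj_imagUnit (F : Type)) (imagUnit_ne_zero (F : Type))) j.1.2)
        j.1.2.2.1 v))
    -- [Liu2021, Prop. 4.13] AS PRINTED over the uniform carriers of record, `H¹_{B,ι₁}(A_∞, ℂ)` read as the tower
    (h413 : ∀ i : (I V (repAt a₀) (muLiu ι₁ GramClass.rep)), Prop413AsPrinted (((uniformOmegaRepId h ⟨F.K⟩ ι₁ (⟨V.Hm, V.isHermitian, V.signature_ι₁, V.posDef_of_ne⟩) Φ e₁ (frameD V)
          (frameD_real V) (frameD_ne V) (ιVE V) (2 * imagUnit (HodgeCM.CMField.K F))⁻¹ (fun _ _ => (repOfLine ⟨F.K⟩ (repAt a₀ (Sigma.fst i)).1 (repAt a₀ (Sigma.fst i)).2.1 (repAt a₀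
          (Sigma.fst i)).2.2)))).prop413Data ((liuDictionaryPin exists_isReal_hodgeModel_holds hodgePQ_independent_of_hodgeModel_holds BallQuotient.ballQuotientUniformised_holds
          (cmAbelianVarietyRealised_of_eigenbasis exists_isReal_hodgeModel_holds hodgePQ_independent_of_hodgeModel_holds cmAbelianVarietyEigenbasisRealised_holds)
          Literature.NumberTheory.Transcendental.arapura2012_cor_15_4_6_holds V (I V (repAt a₀) (muLiu ι₁ GramClass.rep)) (line V (repAt a₀) (muLiu ι₁ GramClass.rep)))).H))
    -- the cross-`μ` separation leg ([Liu2021, App. D Lem. D.1 (3)] with «μ = ⊗_v μ_v»)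
    (hμsep : ∀ (i : (I V (repAt a₀) (muLiu ι₁ GramClass.rep))) (s t : (((uniformOmegaRepId h ⟨F.K⟩ ι₁ (⟨V.Hm, V.isHermitian, V.signature_ι₁, V.posDef_of_ne⟩) Φ e₁ (frameD V)
          (frameD_real V) (frameD_ne V) (ιVE V) (2 * imagUnit (HodgeCM.CMField.K F))⁻¹ (fun _ _ => (repOfLine ⟨F.K⟩ (repAt a₀ (Sigma.fst i)).1 (repAt a₀ (Sigma.fst i)).2.1 (repAt a₀
          (Sigma.fst i)).2.2)))).prop413Data ((liuDictionaryPin exists_isReal_hodgeModel_holds hodgePQ_independent_of_hodgeModel_holds BallQuotient.ballQuotientUniformised_holds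
          (cmAbelianVarietyRealised_of_eigenbasis exists_isReal_hodgeModel_holds hodgePQ_independent_of_hodgeModel_holds cmAbelianVarietyEigenbasisRealised_holds)
          Literature.NumberTheory.Transcendental.arapura2012_cor_15_4_6_holds V (I V (repAt a₀) (muLiu ι₁ GramClass.rep)) (line V (repAt a₀) (muLiu ι₁ GramClass.rep)))).H).AdmTriple),
      Nontrivial ((((uniformOmegaRepId h ⟨F.K⟩ ι₁ (⟨V.Hm, V.isHermitian, V.signature_ι₁, V.posDef_of_ne⟩) Φ e₁ (frameD V) (frameD_real V) (frameD_ne V) (ιVE V) (2 * imagUnit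
            (HodgeCM.CMField.K F))⁻¹ (fun _ _ => (repOfLine ⟨F.K⟩ (repAt a₀ (Sigma.fst i)).1 (repAt a₀ (Sigma.fst i)).2.1 (repAt a₀ (Sigma.fst i)).2.2)))).prop413Data
            ((liuDictionaryPin exists_isReal_hodgeModel_holds hodgePQ_independent_of_hodgeModel_holds BallQuotient.ballQuotientUniformised_holds (cmAbelianVarietyRealised_of_eigenbasis
            exists_isReal_hodgeModel_holds hodgePQ_independent_of_hodgeModel_holds cmAbelianVarietyEigenbasisRealised_holds)
            Literature.NumberTheory.Transcendental.arapura2012_cor_15_4_6_holds V (I V (repAt a₀) (muLiu ι₁ GramClass.rep)) (line V (repAt a₀) (muLiu ι₁ GramClass.rep)))).H).omegaAt s)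
            →
      (∃ f : (((uniformOmegaRepId h ⟨F.K⟩ ι₁ (⟨V.Hm, V.isHermitian, V.signature_ι₁, V.posDef_of_ne⟩) Φ e₁ (frameD V) (frameD_real V) (frameD_ne V) (ιVE V) (2 * imagUnit
            (HodgeCM.CMField.K F))⁻¹ (fun _ _ => (repOfLine ⟨F.K⟩ (repAt a₀ (Sigma.fst i)).1 (repAt a₀ (Sigma.fst i)).2.1 (repAt a₀ (Sigma.fst i)).2.2)))).prop413Data
            ((liuDictionaryPin exists_isReal_hodgeModel_holds hodgePQ_independent_of_hodgeModel_holds BallQuotient.ballQuotientUniformised_holds (cmAbelianVarietyRealised_of_eigenbasis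
            exists_isReal_hodgeModel_holds hodgePQ_independent_of_hodgeModel_holds cmAbelianVarietyEigenbasisRealised_holds)
            Literature.NumberTheory.Transcendental.arapura2012_cor_15_4_6_holds V (I V (repAt a₀) (muLiu ι₁ GramClass.rep)) (line V (repAt a₀) (muLiu ι₁ GramClass.rep)))).H).omegaAt s
            ≃ₗ[ℂ]
          (((uniformOmegaRepId h ⟨F.K⟩ ι₁ (⟨V.Hm, V.isHermitian, V.signature_ι₁, V.posDef_of_ne⟩) Φ e₁ (frameD V) (frameD_real V) (frameD_ne V) (ιVE V) (2 * imagUnit (HodgeCM.CMField.K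
                F))⁻¹ (fun _ _ => (repOfLine ⟨F.K⟩ (repAt a₀ (Sigma.fst i)).1 (repAt a₀ (Sigma.fst i)).2.1 (repAt a₀ (Sigma.fst i)).2.2)))).prop413Data ((liuDictionaryPin
                exists_isReal_hodgeModel_holds hodgePQ_independent_of_hodgeModel_holds BallQuotient.ballQuotientUniformised_holds (cmAbelianVarietyRealised_of_eigenbasis
                exists_isReal_hodgeModel_holds hodgePQ_independent_of_hodgeModel_holds cmAbelianVarietyEigenbasisRealised_holds)
                Literature.NumberTheory.Transcendental.arapura2012_cor_15_4_6_holds V (I V (repAt a₀) (muLiu ι₁ GramClass.rep)) (line V (repAt a₀) (muLiu ι₁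
                GramClass.rep)))).H).omegaAt t,
        ∀ (g : ↥V.adelicFin) (v : (((uniformOmegaRepId h ⟨F.K⟩ ι₁ (⟨V.Hm, V.isHermitian, V.signature_ι₁, V.posDef_of_ne⟩) Φ e₁ (frameD V) (frameD_real V) (frameD_ne V) (ιVE V) (2 *
              imagUnit (HodgeCM.CMField.K F))⁻¹ (fun _ _ => (repOfLine ⟨F.K⟩ (repAt a₀ (Sigma.fst i)).1 (repAt a₀ (Sigma.fst i)).2.1 (repAt a₀ (Sigma.fst i)).2.2)))).prop413Data
              ((liuDictionaryPin exists_isReal_hodgeModel_holds hodgePQ_independent_of_hodgeModel_holds BallQuotient.ballQuotientUniformised_holds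
              (cmAbelianVarietyRealised_of_eigenbasis exists_isReal_hodgeModel_holds hodgePQ_independent_of_hodgeModel_holds cmAbelianVarietyEigenbasisRealised_holds)
              Literature.NumberTheory.Transcendental.arapura2012_cor_15_4_6_holds V (I V (repAt a₀) (muLiu ι₁ GramClass.rep)) (line V (repAt a₀) (muLiu ι₁ GramClass.rep)))).H).omegaAt
              s),
          f ((((uniformOmegaRepId h ⟨F.K⟩ ι₁ (⟨V.Hm, V.isHermitian, V.signature_ι₁, V.posDef_of_ne⟩) Φ e₁ (frameD V) (frameD_real V) (frameD_ne V) (ιVE V) (2 * imagUnit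
                (HodgeCM.CMField.K F))⁻¹ (fun _ _ => (repOfLine ⟨F.K⟩ (repAt a₀ (Sigma.fst i)).1 (repAt a₀ (Sigma.fst i)).2.1 (repAt a₀ (Sigma.fst i)).2.2)))).prop413Data
                ((liuDictionaryPin exists_isReal_hodgeModel_holds hodgePQ_independent_of_hodgeModel_holds BallQuotient.ballQuotientUniformised_holds
                (cmAbelianVarietyRealised_of_eigenbasis exists_isReal_hodgeModel_holds hodgePQ_independent_of_hodgeModel_holds cmAbelianVarietyEigenbasisRealised_holds)
                Literature.NumberTheory.Transcendental.arapura2012_cor_15_4_6_holds V (I V (repAt a₀) (muLiu ι₁ GramClass.rep)) (line V (repAt a₀) (muLiu ι₁ GramClass.rep)))).H).rhoAt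
                s g v) =
            (((uniformOmegaRepId h ⟨F.K⟩ ι₁ (⟨V.Hm, V.isHermitian, V.signature_ι₁, V.posDef_of_ne⟩) Φ e₁ (frameD V) (frameD_real V) (frameD_ne V) (ιVE V) (2 * imagUnit
                  (HodgeCM.CMField.K F))⁻¹ (fun _ _ => (repOfLine ⟨F.K⟩ (repAt a₀ (Sigma.fst i)).1 (repAt a₀ (Sigma.fst i)).2.1 (repAt a₀ (Sigma.fst i)).2.2)))).prop413Data
                  ((liuDictionaryPin exists_isReal_hodgeModel_holds hodgePQ_independent_of_hodgeModel_holds BallQuotient.ballQuotientUniformised_holds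
                  (cmAbelianVarietyRealised_of_eigenbasis exists_isReal_hodgeModel_holds hodgePQ_independent_of_hodgeModel_holds cmAbelianVarietyEigenbasisRealised_holds)
                  Literature.NumberTheory.Transcendental.arapura2012_cor_15_4_6_holds V (I V (repAt a₀) (muLiu ι₁ GramClass.rep)) (line V (repAt a₀) (muLiu ι₁
                  GramClass.rep)))).H).rhoAt t g (f v)) →
      s.1.μ = t.1.μ)
    -- THE Δ2 RESIDUAL OF RECORD (assembler DECISION #13 §1): (c) the J-record pin and (d) the pieces, in `PinSignatures`' currency
    (M : ∀ (i : (I V (repAt a₀) (muLiu ι₁ GramClass.rep))) (μ : Literature.NumberTheory.Automorphic.IdeleClassGroup (F : Type) →ₜ* Circle)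
      (hμ : IdeleClassGroup.IsConjugateSymplectic (F : Type) μ) (hw : IdeleClassGroup.HasWeight (F : Type) μ 1),
      (toThm418Data _ (((uniformOmegaRepId h ⟨F.K⟩ ι₁ (⟨V.Hm, V.isHermitian, V.signature_ι₁, V.posDef_of_ne⟩) Φ e₁ (frameD V) (frameD_real V) (frameD_ne V) (ιVE V) (2 * imagUnit
            (HodgeCM.CMField.K F))⁻¹ (fun _ _ => (repOfLine ⟨F.K⟩ (repAt a₀ (Sigma.fst i)).1 (repAt a₀ (Sigma.fst i)).2.1 (repAt a₀ (Sigma.fst i)).2.2)))).rest (restTailOne (AlgHom.id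
            ℚ _) ι₁ hμ hw (Def45.Carriers.ofPolDR μ (Def45.PolDR ι₁ hμ (Def45.RMuForm ι₁ hμ))) ((heckeTranslatesFamilyIdOf heckeTranslate_definedOver_holds h isoOf ⟨F.K⟩ ι₁ (⟨V.Hm,
            V.isHermitian, V.signature_ι₁, V.posDef_of_ne⟩) Φ h6).rhoΩOne (AlgHom.id ℚ _) ι₁ hμ hw (Def45.Carriers.ofPolDR μ (Def45.PolDR ι₁ hμ (Def45.RMuForm ι₁
            hμ))))))).Map43RationalData)
    (jH : ∀ (i : (I V (repAt a₀) (muLiu ι₁ GramClass.rep))) (μ : Literature.NumberTheory.Automorphic.IdeleClassGroup (F : Type) →ₜ* Circle)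
      (hμ : IdeleClassGroup.IsConjugateSymplectic (F : Type) μ) (hw : IdeleClassGroup.HasWeight (F : Type) μ 1),
      (M i μ hμ hw).HB →ₗ[ℂ] ((liuDictionaryPin exists_isReal_hodgeModel_holds hodgePQ_independent_of_hodgeModel_holds BallQuotient.ballQuotientUniformised_holds
            (cmAbelianVarietyRealised_of_eigenbasis exists_isReal_hodgeModel_holds hodgePQ_independent_of_hodgeModel_holds cmAbelianVarietyEigenbasisRealised_holds)
            Literature.NumberTheory.Transcendental.arapura2012_cor_15_4_6_holds V (I V (repAt a₀) (muLiu ι₁ GramClass.rep)) (line V (repAt a₀) (muLiu ι₁ GramClass.rep)))).H)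
    (hjHinj : ∀ (i : (I V (repAt a₀) (muLiu ι₁ GramClass.rep))) (μ : Literature.NumberTheory.Automorphic.IdeleClassGroup (F : Type) →ₜ* Circle)
      (hμ : IdeleClassGroup.IsConjugateSymplectic (F : Type) μ) (hw : IdeleClassGroup.HasWeight (F : Type) μ 1), Function.Injective (jH i μ hμ hw))
    (hjH : ∀ (i : (I V (repAt a₀) (muLiu ι₁ GramClass.rep))) (μ : Literature.NumberTheory.Automorphic.IdeleClassGroup (F : Type) →ₜ* Circle)
      (hμ : IdeleClassGroup.IsConjugateSymplectic (F : Type) μ) (hw : IdeleClassGroup.HasWeight (F : Type) μ 1) (g : ↥V.adelicFin)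
      (x : (M i μ hμ hw).HB), jH i μ hμ hw ((M i μ hμ hw).ρB g x) = MonoidAlgebra.of ℂ ↥V.adelicFin g • jH i μ hμ hw x)
    (pieces : ∀ (i : (I V (repAt a₀) (muLiu ι₁ GramClass.rep))) (μ : Literature.NumberTheory.Automorphic.IdeleClassGroup (F : Type) →ₜ* Circle)
      (hμ : IdeleClassGroup.IsConjugateSymplectic (F : Type) μ) (hw : IdeleClassGroup.HasWeight (F : Type) μ 1) (K : HodgeCM.Level V),
      K ≤ (HodgeCM.Level.capThree (V := V) (((sec42DataIdOf h isoOf ⟨F.K⟩ ι₁ (⟨V.Hm, V.isHermitian, V.signature_ι₁, V.posDef_of_ne⟩) Φ)).S.K₀.1 : Subgroup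
            ↥(HodgeCM.HermSpace3.adelicFin V)) ((sec42DataIdOf h isoOf ⟨F.K⟩ ι₁ (⟨V.Hm, V.isHermitian, V.signature_ι₁, V.posDef_of_ne⟩) Φ)).S.K₀.2.1) →
      HcmPieces.{0, 1, 0} (toThm418Data _ (((uniformOmegaRepId h ⟨F.K⟩ ι₁ (⟨V.Hm, V.isHermitian, V.signature_ι₁, V.posDef_of_ne⟩) Φ e₁ (frameD V) (frameD_real V) (frameD_ne V) (ιVE V)
            (2 * imagUnit (HodgeCM.CMField.K F))⁻¹ (fun _ _ => (repOfLine ⟨F.K⟩ (repAt a₀ (Sigma.fst i)).1 (repAt a₀ (Sigma.fst i)).2.1 (repAt a₀ (Sigma.fst i)).2.2)))).rest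
            (restTailOne (AlgHom.id ℚ _) ι₁ hμ hw (Def45.Carriers.ofPolDR μ (Def45.PolDR ι₁ hμ (Def45.RMuForm ι₁ hμ))) ((heckeTranslatesFamilyIdOf heckeTranslate_definedOver_holds h
            isoOf ⟨F.K⟩ ι₁ (⟨V.Hm, V.isHermitian, V.signature_ι₁, V.posDef_of_ne⟩) Φ h6).rhoΩOne (AlgHom.id ℚ _) ι₁ hμ hw (Def45.Carriers.ofPolDR μ (Def45.PolDR ι₁ hμ (Def45.RMuForm ι₁
            hμ))))))) (M i μ hμ hw) ((liuDictionaryPin exists_isReal_hodgeModel_holds hodgePQ_independent_of_hodgeModel_holds BallQuotient.ballQuotientUniformised_holds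
            (cmAbelianVarietyRealised_of_eigenbasis exists_isReal_hodgeModel_holds hodgePQ_independent_of_hodgeModel_holds cmAbelianVarietyEigenbasisRealised_holds)
            Literature.NumberTheory.Transcendental.arapura2012_cor_15_4_6_holds V (I V (repAt a₀) (muLiu ι₁ GramClass.rep)) (line V (repAt a₀) (muLiu ι₁ GramClass.rep)))).H
        (jH i μ hμ hw) K.K
        ((HodgeCM.Model.picardCMUniverse exists_isReal_hodgeModel_holds hodgePQ_independent_of_hodgeModel_holds
            BallQuotient.ballQuotientUniformised_holds
            (cmAbelianVarietyRealised_of_eigenbasis exists_isReal_hodgeModel_holds hodgePQ_independent_of_hodgeModel_holds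
              cmAbelianVarietyEigenbasisRealised_holds)).CohC
          ((HodgeCM.Model.picardCMUniverse exists_isReal_hodgeModel_holds hodgePQ_independent_of_hodgeModel_holds
            BallQuotient.ballQuotientUniformised_holds
            (cmAbelianVarietyRealised_of_eigenbasis exists_isReal_hodgeModel_holds hodgePQ_independent_of_hodgeModel_holds
              cmAbelianVarietyEigenbasisRealised_holds)).pms F ι₁ V K) 1)
        (resTotal exists_isReal_hodgeModel_holds hodgePQ_independent_of_hodgeModel_holds
          (ballQuotientUniformisedDatum_of BallQuotient.ballQuotientUniformised_holds)
          (cmAbelianVarietyRealised_of_eigenbasis exists_isReal_hodgeModel_holds hodgePQ_independent_of_hodgeModel_holds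
            cmAbelianVarietyEigenbasisRealised_holds)
          Literature.NumberTheory.Transcendental.arapura2012_cor_15_4_6_holds K)
        (((liuDictionaryPin exists_isReal_hodgeModel_holds hodgePQ_independent_of_hodgeModel_holds BallQuotient.ballQuotientUniformised_holds (cmAbelianVarietyRealised_of_eigenbasis
              exists_isReal_hodgeModel_holds hodgePQ_independent_of_hodgeModel_holds cmAbelianVarietyEigenbasisRealised_holds)
              Literature.NumberTheory.Transcendental.arapura2012_cor_15_4_6_holds V (I V (repAt a₀) (muLiu ι₁ GramClass.rep)) (line V (repAt a₀) (muLiu ι₁ GramClass.rep)))).cmClasses K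
              i)) :
    ((liuDictionaryPin exists_isReal_hodgeModel_holds hodgePQ_independent_of_hodgeModel_holds BallQuotient.ballQuotientUniformised_holds (cmAbelianVarietyRealised_of_eigenbasis
          exists_isReal_hodgeModel_holds hodgePQ_independent_of_hodgeModel_holds cmAbelianVarietyEigenbasisRealised_holds)
          Literature.NumberTheory.Transcendental.arapura2012_cor_15_4_6_holds V (I V (repAt a₀) (muLiu ι₁ GramClass.rep)) (line V (repAt a₀) (muLiu ι₁ GramClass.rep)))).Thm418C := by
  -- F4's `ω ≠ 0` lives at the TWISTED rest of record; I3's field transport makes `AdmIndex ∕ omegaAt` of `(𝕌₁ i).rest 𝔱₁` and of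
  -- `(𝕌₀ i).rest 𝔱₀` the SAME types (`admIndex_rest_uniformOmegaRepId_eq` ∕ `omegaAt_rest_uniformOmegaRepId_eq`, `rfl`), so the twisted theorem
  -- is reused verbatim through `restOfCharRep_eq_rest` (own-htheta, `rfl`).
  have hR₀ : ∀ (i : (I V (repAt a₀) (muLiu ι₁ GramClass.rep))) (μ : Literature.NumberTheory.Automorphic.IdeleClassGroup (F : Type) →ₜ* Circle)
      (hμ : IdeleClassGroup.IsConjugateSymplectic (F : Type) μ) (hw : IdeleClassGroup.HasWeight (F : Type) μ 1),
      (restOfCharDeltaPrimeLine h ⟨F.K⟩ h6 ι₁ (⟨V.Hm, V.isHermitian, V.signature_ι₁, V.posDef_of_ne⟩) Φ e₁ (frameD V) (frameD_real V) (frameD_ne V) (ιVE V) (repAt a₀ (Sigma.fst i)).1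
            (repAt a₀ (Sigma.fst i)).2.1 (repAt a₀ (Sigma.fst i)).2.2 μ hμ hw) = ((uniformOmegaRep h ⟨F.K⟩ ι₁ (⟨V.Hm, V.isHermitian, V.signature_ι₁, V.posDef_of_ne⟩) Φ e₁ (frameD V)
            (frameD_real V) (frameD_ne V) (ιVE V) (2 * imagUnit (HodgeCM.CMField.K F))⁻¹ (fun _ _ => (repOfLine ⟨F.K⟩ (repAt a₀ (Sigma.fst i)).1 (repAt a₀ (Sigma.fst i)).2.1 (repAt a₀
            (Sigma.fst i)).2.2)))).rest (restTailOne (AlgHom.id ℚ _) ι₁ hμ hw (Def45.Carriers.ofPolDR μ (Def45.PolDR ι₁ hμ (Def45.RMuForm ι₁ hμ))) ((heckeTranslatesFamilyOf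
            heckeTranslate_definedOver_holds h isoOf ⟨F.K⟩ ι₁ (⟨V.Hm, V.isHermitian, V.signature_ι₁, V.posDef_of_ne⟩) Φ h6).rhoΩOne (AlgHom.id ℚ _) ι₁ hμ hw (Def45.Carriers.ofPolDR μ
            (Def45.PolDR ι₁ hμ (Def45.RMuForm ι₁ hμ))))) := fun i μ hμ hw =>
    restOfCharRep_eq_rest h ⟨F.K⟩ ι₁ (⟨V.Hm, V.isHermitian, V.signature_ι₁, V.posDef_of_ne⟩) Φ e₁ (frameD V) (frameD_real V) (frameD_ne V) (ιVE V) (2 * imagUnit (F : Type))⁻¹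
      (fun _ _ => (repOfLine ⟨F.K⟩ (repAt a₀ (Sigma.fst i)).1 (repAt a₀ (Sigma.fst i)).2.1 (repAt a₀ (Sigma.fst i)).2.2)) h6 μ hμ hw
  -- (b) THE Ω-PIN AT THE INDEX OF RECORD, BY VALUE: prove-7's ✔ `OmegaPin.exists_pinTerms_indexOfRecord` at the TWISTED uniform rests
  --     `(𝕌₀ i).rest 𝔱₀` (seam `hR₀`), then carried to the Id rests `(𝕌₁ i).rest 𝔱₁` by cmside-a's generic-tail transport
  --     ✔-desk `Model.exists_omegaPin_transport_uniformOmegaRepId` (I3; `AdmIndex ∕ omegaAt ∕ rhoAt` agree by `rfl` at generic tails) — no I9 import.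
  obtain ⟨μ, hμ, hw, σ, e, -, hσ, he⟩ :=
    HodgeCM.Model.LiuIndex.OmegaPin.exists_pinTerms_indexOfRecord V a₀ (ιVE V) h h6 Φ hV
      (fun i _ _ μ hμ hw => ((uniformOmegaRep h ⟨F.K⟩ ι₁ (⟨V.Hm, V.isHermitian, V.signature_ι₁, V.posDef_of_ne⟩) Φ e₁ (frameD V) (frameD_real V) (frameD_ne V) (ιVE V) (2 * imagUnit
            (HodgeCM.CMField.K F))⁻¹ (fun _ _ => (repOfLine ⟨F.K⟩ (repAt a₀ (Sigma.fst i)).1 (repAt a₀ (Sigma.fst i)).2.1 (repAt a₀ (Sigma.fst i)).2.2)))).rest (restTailOne (AlgHom.id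
            ℚ _) ι₁ hμ hw (Def45.Carriers.ofPolDR μ (Def45.PolDR ι₁ hμ (Def45.RMuForm ι₁ hμ))) ((heckeTranslatesFamilyOf heckeTranslate_definedOver_holds h isoOf ⟨F.K⟩ ι₁ (⟨V.Hm,
            V.isHermitian, V.signature_ι₁, V.posDef_of_ne⟩) Φ h6).rhoΩOne (AlgHom.id ℚ _) ι₁ hμ hw (Def45.Carriers.ofPolDR μ (Def45.PolDR ι₁ hμ (Def45.RMuForm ι₁ hμ)))))) (fun i _ _ μ
            hμ hw => hR₀ i μ hμ hw)
  choose σI eI hσI heI using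
    fun (i : (I V (repAt a₀) (muLiu ι₁ GramClass.rep))) (hi : SplitLine.PhiMuLine ι₁ ((line V (repAt a₀) (muLiu ι₁ GramClass.rep)) i)) (hg : Continuous (i.2.1 : SplittingAt V (repAt a₀
          i.1))) =>
      exists_omegaPin_transport_uniformOmegaRepId h ⟨F.K⟩ ι₁ (⟨V.Hm, V.isHermitian, V.signature_ι₁, V.posDef_of_ne⟩) Φ e₁ (frameD V) (frameD_real V) (frameD_ne V) (ιVE V)
        (2 * imagUnit (HodgeCM.CMField.K F))⁻¹ (fun _ _ => (repOfLine ⟨F.K⟩ (repAt a₀ (Sigma.fst i)).1 (repAt a₀ (Sigma.fst i)).2.1 (repAt a₀ (Sigma.fst i)).2.2))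
        (restTailOne (AlgHom.id ℚ _) ι₁ (hμ i hi hg) (hw i hi hg) (Def45.Carriers.ofPolDR (μ i hi hg) (Def45.PolDR ι₁ (hμ i hi hg) (Def45.RMuForm ι₁ (hμ i hi hg))))
              ((heckeTranslatesFamilyIdOf heckeTranslate_definedOver_holds h isoOf ⟨F.K⟩ ι₁ (⟨V.Hm, V.isHermitian, V.signature_ι₁, V.posDef_of_ne⟩) Φ h6).rhoΩOne (AlgHom.id ℚ _) ι₁ (hμ
              i hi hg) (hw i hi hg) (Def45.Carriers.ofPolDR (μ i hi hg) (Def45.PolDR ι₁ (hμ i hi hg) (Def45.RMuForm ι₁ (hμ i hi hg)))))) (restTailOne (AlgHom.id ℚ _) ι₁ (hμ i hi hg)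
              (hw i hi hg) (Def45.Carriers.ofPolDR (μ i hi hg) (Def45.PolDR ι₁ (hμ i hi hg) (Def45.RMuForm ι₁ (hμ i hi hg)))) ((heckeTranslatesFamilyOf heckeTranslate_definedOver_holds
              h isoOf ⟨F.K⟩ ι₁ (⟨V.Hm, V.isHermitian, V.signature_ι₁, V.posDef_of_ne⟩) Φ h6).rhoΩOne (AlgHom.id ℚ _) ι₁ (hμ i hi hg) (hw i hi hg) (Def45.Carriers.ofPolDR (μ i hi hg)
              (Def45.PolDR ι₁ (hμ i hi hg) (Def45.RMuForm ι₁ (hμ i hi hg))))))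
        (fun (a : {χ : ((line V (repAt a₀) (muLiu ι₁ GramClass.rep)) i).CharW // ((line V (repAt a₀) (muLiu ι₁ GramClass.rep)) i).IsAutChar χ}) (g : ↥V.adelicFin) (m : ((line V (repAt
              a₀) (muLiu ι₁ GramClass.rep)) i).Ω (ιVE V) a.1) =>
          MonoidAlgebra.of ℂ ↥V.adelicFin g • m)
        (σ i hi hg) (e i hi hg) (hσ i hi hg) (he i hi hg)
  -- [Lem D.1 (1)] ⟹ `ω ≠ 0` at the Id rests: F4 at the twisted rest, re-typed by `rfl` (I3 field transport)
  have hιs : Function.Surjective (ιVE V) :=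
    (isHomeomorph_finPart_cmKTypeHom_finAdelicToAdelic (F : Type) V.Hm (frameG V) (frameD V) (frame_congr V)).surjective
  have hnvD₀ : ∀ (i : (I V (repAt a₀) (muLiu ι₁ GramClass.rep))) (μ : Literature.NumberTheory.Automorphic.IdeleClassGroup (F : Type) →ₜ* Circle)
      (hμ : IdeleClassGroup.IsConjugateSymplectic (F : Type) μ) (hw : IdeleClassGroup.HasWeight (F : Type) μ 1)
      (j : (toThm418Data _ (((uniformOmegaRep h ⟨F.K⟩ ι₁ (⟨V.Hm, V.isHermitian, V.signature_ι₁, V.posDef_of_ne⟩) Φ e₁ (frameD V) (frameD_real V) (frameD_ne V) (ιVE V) (2 * imagUnit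
            (HodgeCM.CMField.K F))⁻¹ (fun _ _ => (repOfLine ⟨F.K⟩ (repAt a₀ (Sigma.fst i)).1 (repAt a₀ (Sigma.fst i)).2.1 (repAt a₀ (Sigma.fst i)).2.2)))).rest (restTailOne (AlgHom.id
            ℚ _) ι₁ hμ hw (Def45.Carriers.ofPolDR μ (Def45.PolDR ι₁ hμ (Def45.RMuForm ι₁ hμ))) ((heckeTranslatesFamilyOf heckeTranslate_definedOver_holds h isoOf ⟨F.K⟩ ι₁ (⟨V.Hm,
            V.isHermitian, V.signature_ι₁, V.posDef_of_ne⟩) Φ h6).rhoΩOne (AlgHom.id ℚ _) ι₁ hμ hw (Def45.Carriers.ofPolDR μ (Def45.PolDR ι₁ hμ (Def45.RMuForm ι₁ hμ))))))).AdmIndex),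
      Nontrivial ((toThm418Data _ (((uniformOmegaRep h ⟨F.K⟩ ι₁ (⟨V.Hm, V.isHermitian, V.signature_ι₁, V.posDef_of_ne⟩) Φ e₁ (frameD V) (frameD_real V) (frameD_ne V) (ιVE V) (2 *
            imagUnit (HodgeCM.CMField.K F))⁻¹ (fun _ _ => (repOfLine ⟨F.K⟩ (repAt a₀ (Sigma.fst i)).1 (repAt a₀ (Sigma.fst i)).2.1 (repAt a₀ (Sigma.fst i)).2.2)))).rest (restTailOne
            (AlgHom.id ℚ _) ι₁ hμ hw (Def45.Carriers.ofPolDR μ (Def45.PolDR ι₁ hμ (Def45.RMuForm ι₁ hμ))) ((heckeTranslatesFamilyOf heckeTranslate_definedOver_holds h isoOf ⟨F.K⟩ ι₁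
            (⟨V.Hm, V.isHermitian, V.signature_ι₁, V.posDef_of_ne⟩) Φ h6).rhoΩOne (AlgHom.id ℚ _) ι₁ hμ hw (Def45.Carriers.ofPolDR μ (Def45.PolDR ι₁ hμ (Def45.RMuForm ι₁
            hμ))))))).omegaAt j) := fun i μ hμ hw => by
    rw [← hR₀]
    exact fun j => nontrivial_omegaAt_restOfCharDeltaPrime_of_lemD1AsPrinted h ⟨F.K⟩ h6 ι₁ (⟨V.Hm, V.isHermitian, V.signature_ι₁, V.posDef_of_ne⟩) Φ e₁ (frameD V) (frameD_real V)
      (frameD_ne V) (ιVE V) (repOfLine ⟨F.K⟩ (repAt a₀ (Sigma.fst i)).1 (repAt a₀ (Sigma.fst i)).2.1 (repAt a₀ (Sigma.fst i)).2.2) μ hμ hw hιs (le_refl 3) j (hD1 i μ hμ hw j)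
  -- … carried to the Id rests by cmside-a's generic-tail transport (I3 `Model.nontrivial_omegaAt_transport_uniformOmegaRepId`)
  have hnvD : ∀ (i : (I V (repAt a₀) (muLiu ι₁ GramClass.rep))) (μ : Literature.NumberTheory.Automorphic.IdeleClassGroup (F : Type) →ₜ* Circle)
      (hμ : IdeleClassGroup.IsConjugateSymplectic (F : Type) μ) (hw : IdeleClassGroup.HasWeight (F : Type) μ 1)
      (j : (toThm418Data _ (((uniformOmegaRepId h ⟨F.K⟩ ι₁ (⟨V.Hm, V.isHermitian, V.signature_ι₁, V.posDef_of_ne⟩) Φ e₁ (frameD V) (frameD_real V) (frameD_ne V) (ιVE V) (2 * imagUnit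
            (HodgeCM.CMField.K F))⁻¹ (fun _ _ => (repOfLine ⟨F.K⟩ (repAt a₀ (Sigma.fst i)).1 (repAt a₀ (Sigma.fst i)).2.1 (repAt a₀ (Sigma.fst i)).2.2)))).rest (restTailOne (AlgHom.id
            ℚ _) ι₁ hμ hw (Def45.Carriers.ofPolDR μ (Def45.PolDR ι₁ hμ (Def45.RMuForm ι₁ hμ))) ((heckeTranslatesFamilyIdOf heckeTranslate_definedOver_holds h isoOf ⟨F.K⟩ ι₁ (⟨V.Hm,
            V.isHermitian, V.signature_ι₁, V.posDef_of_ne⟩) Φ h6).rhoΩOne (AlgHom.id ℚ _) ι₁ hμ hw (Def45.Carriers.ofPolDR μ (Def45.PolDR ι₁ hμ (Def45.RMuForm ι₁ hμ))))))).AdmIndex),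
      Nontrivial ((toThm418Data _ (((uniformOmegaRepId h ⟨F.K⟩ ι₁ (⟨V.Hm, V.isHermitian, V.signature_ι₁, V.posDef_of_ne⟩) Φ e₁ (frameD V) (frameD_real V) (frameD_ne V) (ιVE V) (2 *
            imagUnit (HodgeCM.CMField.K F))⁻¹ (fun _ _ => (repOfLine ⟨F.K⟩ (repAt a₀ (Sigma.fst i)).1 (repAt a₀ (Sigma.fst i)).2.1 (repAt a₀ (Sigma.fst i)).2.2)))).rest (restTailOne
            (AlgHom.id ℚ _) ι₁ hμ hw (Def45.Carriers.ofPolDR μ (Def45.PolDR ι₁ hμ (Def45.RMuForm ι₁ hμ))) ((heckeTranslatesFamilyIdOf heckeTranslate_definedOver_holds h isoOf ⟨F.K⟩ ι₁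
            (⟨V.Hm, V.isHermitian, V.signature_ι₁, V.posDef_of_ne⟩) Φ h6).rhoΩOne (AlgHom.id ℚ _) ι₁ hμ hw (Def45.Carriers.ofPolDR μ (Def45.PolDR ι₁ hμ (Def45.RMuForm ι₁
            hμ))))))).omegaAt j) := fun i μ hμ hw j =>
    nontrivial_omegaAt_transport_uniformOmegaRepId h ⟨F.K⟩ ι₁ (⟨V.Hm, V.isHermitian, V.signature_ι₁, V.posDef_of_ne⟩) Φ e₁ (frameD V) (frameD_real V) (frameD_ne V) (ιVE V)
      (2 * imagUnit (HodgeCM.CMField.K F))⁻¹ (fun _ _ => (repOfLine ⟨F.K⟩ (repAt a₀ (Sigma.fst i)).1 (repAt a₀ (Sigma.fst i)).2.1 (repAt a₀ (Sigma.fst i)).2.2)) (restTailOne (AlgHom.id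
            ℚ _) ι₁ hμ hw (Def45.Carriers.ofPolDR μ (Def45.PolDR ι₁ hμ (Def45.RMuForm ι₁ hμ))) ((heckeTranslatesFamilyIdOf heckeTranslate_definedOver_holds h isoOf ⟨F.K⟩ ι₁ (⟨V.Hm,
            V.isHermitian, V.signature_ι₁, V.posDef_of_ne⟩) Φ h6).rhoΩOne (AlgHom.id ℚ _) ι₁ hμ hw (Def45.Carriers.ofPolDR μ (Def45.PolDR ι₁ hμ (Def45.RMuForm ι₁ hμ))))) (restTailOne
            (AlgHom.id ℚ _) ι₁ hμ hw (Def45.Carriers.ofPolDR μ (Def45.PolDR ι₁ hμ (Def45.RMuForm ι₁ hμ))) ((heckeTranslatesFamilyOf heckeTranslate_definedOver_holds h isoOf ⟨F.K⟩ ι₁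
            (⟨V.Hm, V.isHermitian, V.signature_ι₁, V.posDef_of_ne⟩) Φ h6).rhoΩOne (AlgHom.id ℚ _) ι₁ hμ hw (Def45.Carriers.ofPolDR μ (Def45.PolDR ι₁ hμ (Def45.RMuForm ι₁ hμ)))))
      (hnvD₀ i μ hμ hw) j
  exact Summit.HodgeConjecture.CorCM.D2Bridge.PinSignatures.thm418C_liuDictionaryPin_of_pinsId V (I V (repAt a₀) (muLiu ι₁ GramClass.rep))
    (line V (repAt a₀) (muLiu ι₁ GramClass.rep)) h Φ (sec42DataIdOf h isoOf ⟨F.K⟩ ι₁ (⟨V.Hm, V.isHermitian, V.signature_ι₁, V.posDef_of_ne⟩) Φ) (fun i => Continuous (i.2.1 :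
          SplittingAt V (repAt a₀ i.1)))
    -- block vanishing at the NON-CONTINUOUS index lines — BY VALUE: a compatible index splitting with a central type and SMOOTH finite Weil
    -- representation is continuous (pin-3 `continuous_of_hasCentralTypeAt_of_smooth`, frame transport open), and at a non-smooth line the block
    -- vanishes (own-htheta `block_pin_lineOf_eq_bot_of_not_smooth`, [GR91 Prop. 3.1.1] discharged by `compatibleSplitting_cmSplittingDatum`)
    (fun i _ hnc => Transposition.BlockVanishing.block_pin_lineOf_eq_bot_of_not_smooth exists_isReal_hodgeModel_holds
        hodgePQ_independent_of_hodgeModel_holds BallQuotient.ballQuotientUniformised_holds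
        (cmAbelianVarietyRealised_of_eigenbasis exists_isReal_hodgeModel_holds hodgePQ_independent_of_hodgeModel_holds
          cmAbelianVarietyEigenbasisRealised_holds)
        Literature.NumberTheory.Transcendental.arapura2012_cor_15_4_6_holds V (repAt a₀) (CentralTypeIs V (muLiu ι₁ GramClass.rep)) i fun hsm =>
      hnc (Transposition.CentralTypeAtPin.continuous_of_hasCentralTypeAt_of_smooth V (repAt a₀ i.1) i.2.1
        (isCompatAt_of_mem V (repAt a₀) (muLiu ι₁ GramClass.rep) i) (hasCentralTypeAt_of_mem V (repAt a₀) (muLiu ι₁ GramClass.rep) i) (ιVE V)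
        (continuous_ιVE V) (isHomeomorph_finPart_cmKTypeHom_finAdelicToAdelic (F : Type) V.Hm (frameG V) (frameD V) (frame_congr V)).isOpenMap
        hsm.1 hsm.2))
    -- (a) U ∕ R₀ ∕ tail ∕ hLiu — BY VALUE
    (fun i _ _ => (uniformOmegaRepId h ⟨F.K⟩ ι₁ (⟨V.Hm, V.isHermitian, V.signature_ι₁, V.posDef_of_ne⟩) Φ e₁ (frameD V) (frameD_real V) (frameD_ne V) (ιVE V) (2 * imagUnit
          (HodgeCM.CMField.K F))⁻¹ (fun _ _ => (repOfLine ⟨F.K⟩ (repAt a₀ (Sigma.fst i)).1 (repAt a₀ (Sigma.fst i)).2.1 (repAt a₀ (Sigma.fst i)).2.2))))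
    (fun i hi hg => ((uniformOmegaRepId h ⟨F.K⟩ ι₁ (⟨V.Hm, V.isHermitian, V.signature_ι₁, V.posDef_of_ne⟩) Φ e₁ (frameD V) (frameD_real V) (frameD_ne V) (ιVE V) (2 * imagUnit
          (HodgeCM.CMField.K F))⁻¹ (fun _ _ => (repOfLine ⟨F.K⟩ (repAt a₀ (Sigma.fst i)).1 (repAt a₀ (Sigma.fst i)).2.1 (repAt a₀ (Sigma.fst i)).2.2)))).rest (restTailOne (AlgHom.id ℚ
          _) ι₁ (hμ i hi hg) (hw i hi hg) (Def45.Carriers.ofPolDR (μ i hi hg) (Def45.PolDR ι₁ (hμ i hi hg) (Def45.RMuForm ι₁ (hμ i hi hg)))) ((heckeTranslatesFamilyIdOf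
          heckeTranslate_definedOver_holds h isoOf ⟨F.K⟩ ι₁ (⟨V.Hm, V.isHermitian, V.signature_ι₁, V.posDef_of_ne⟩) Φ h6).rhoΩOne (AlgHom.id ℚ _) ι₁ (hμ i hi hg) (hw i hi hg)
          (Def45.Carriers.ofPolDR (μ i hi hg) (Def45.PolDR ι₁ (hμ i hi hg) (Def45.RMuForm ι₁ (hμ i hi hg)))))))
    (fun i hi hg => (restTailOne (AlgHom.id ℚ _) ι₁ (hμ i hi hg) (hw i hi hg) (Def45.Carriers.ofPolDR (μ i hi hg) (Def45.PolDR ι₁ (hμ i hi hg) (Def45.RMuForm ι₁ (hμ i hi hg))))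
          ((heckeTranslatesFamilyIdOf heckeTranslate_definedOver_holds h isoOf ⟨F.K⟩ ι₁ (⟨V.Hm, V.isHermitian, V.signature_ι₁, V.posDef_of_ne⟩) Φ h6).rhoΩOne (AlgHom.id ℚ _) ι₁ (hμ i
          hi hg) (hw i hi hg) (Def45.Carriers.ofPolDR (μ i hi hg) (Def45.PolDR ι₁ (hμ i hi hg) (Def45.RMuForm ι₁ (hμ i hi hg)))))))
    (fun i hi hg => hLiu i (μ i hi hg) (hμ i hi hg) (hw i hi hg))
    -- (b) the Ω-pin (transported to the Id rests)
    σI hσI eI heI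
    -- (c) the J-record pin — BY NAME at the characters of the Ω-pin
    (fun i hi hg => M i (μ i hi hg) (hμ i hi hg) (hw i hi hg)) (fun i hi hg => jH i (μ i hi hg) (hμ i hi hg) (hw i hi hg))
    (fun i hi hg => hjHinj i (μ i hi hg) (hμ i hi hg) (hw i hi hg)) (fun i hi hg => hjH i (μ i hi hg) (hμ i hi hg) (hw i hi hg))
    -- (d) the pieces below the App-C threshold — BY NAME
    (fun _ => (HodgeCM.Level.capThree (V := V) (((sec42DataIdOf h isoOf ⟨F.K⟩ ι₁ (⟨V.Hm, V.isHermitian, V.signature_ι₁, V.posDef_of_ne⟩) Φ)).S.K₀.1 : Subgroup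
          ↥(HodgeCM.HermSpace3.adelicFin V)) ((sec42DataIdOf h isoOf ⟨F.K⟩ ι₁ (⟨V.Hm, V.isHermitian, V.signature_ι₁, V.posDef_of_ne⟩) Φ)).S.K₀.2.1)) (fun i hi hg K hK => pieces i (μ i
          hi hg) (hμ i hi hg) (hw i hi hg) K hK)
    -- [Lem D.1 (1)], [Prop 4.13], [Def 4.11], [Thm 4.18 (2)] ∕ [Lem D.1 (3)] — BY VALUE from the displayed as-printed families
    (fun i hi hg j => hnvD i (μ i hi hg) (hμ i hi hg) (hw i hi hg) j) (fun i _ _ => h413 i)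
    (fun i _ _ => ((uniformOmegaRepId h ⟨F.K⟩ ι₁ (⟨V.Hm, V.isHermitian, V.signature_ι₁, V.posDef_of_ne⟩) Φ e₁ (frameD V) (frameD_real V) (frameD_ne V) (ιVE V) (2 * imagUnit
          (HodgeCM.CMField.K F))⁻¹ (fun _ _ => (repOfLine ⟨F.K⟩ (repAt a₀ (Sigma.fst i)).1 (repAt a₀ (Sigma.fst i)).2.1 (repAt a₀ (Sigma.fst
          i)).2.2)))).adjectives_rhoAt_prop413Data_of_def411AsPrinted_rest _
      (fun μ hμ hw => (restTailOne (AlgHom.id ℚ _) ι₁ hμ hw (Def45.Carriers.ofPolDR μ (Def45.PolDR ι₁ hμ (Def45.RMuForm ι₁ hμ))) ((heckeTranslatesFamilyIdOf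
            heckeTranslate_definedOver_holds h isoOf ⟨F.K⟩ ι₁ (⟨V.Hm, V.isHermitian, V.signature_ι₁, V.posDef_of_ne⟩) Φ h6).rhoΩOne (AlgHom.id ℚ _) ι₁ hμ hw (Def45.Carriers.ofPolDR μ
            (Def45.PolDR ι₁ hμ (Def45.RMuForm ι₁ hμ)))))) (h411R i))
    (fun i _ _ => ((uniformOmegaRepId h ⟨F.K⟩ ι₁ (⟨V.Hm, V.isHermitian, V.signature_ι₁, V.posDef_of_ne⟩) Φ e₁ (frameD V) (frameD_real V) (frameD_ne V) (ιVE V) (2 * imagUnit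
          (HodgeCM.CMField.K F))⁻¹ (fun _ _ => (repOfLine ⟨F.K⟩ (repAt a₀ (Sigma.fst i)).1 (repAt a₀ (Sigma.fst i)).2.1 (repAt a₀ (Sigma.fst
          i)).2.2)))).admTriple_eq_of_areIsomorphic_of_thm418AsPrinted_rest _
      (fun μ hμ hw => (restTailOne (AlgHom.id ℚ _) ι₁ hμ hw (Def45.Carriers.ofPolDR μ (Def45.PolDR ι₁ hμ (Def45.RMuForm ι₁ hμ))) ((heckeTranslatesFamilyIdOf
            heckeTranslate_definedOver_holds h isoOf ⟨F.K⟩ ι₁ (⟨V.Hm, V.isHermitian, V.signature_ι₁, V.posDef_of_ne⟩) Φ h6).rhoΩOne (AlgHom.id ℚ _) ι₁ hμ hw (Def45.Carriers.ofPolDR μ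
            (Def45.PolDR ι₁ hμ (Def45.RMuForm ι₁ hμ)))))) (hLiu i) (hμsep i))
    -- `hK`: a model level is open compact — BY VALUE
    ⟨((HodgeCM.Level.capThree (V := V) (((sec42DataIdOf h isoOf ⟨F.K⟩ ι₁ (⟨V.Hm, V.isHermitian, V.signature_ι₁, V.posDef_of_ne⟩) Φ)).S.K₀.1 : Subgroup ↥(HodgeCM.HermSpace3.adelicFin
          V)) ((sec42DataIdOf h isoOf ⟨F.K⟩ ι₁ (⟨V.Hm, V.isHermitian, V.signature_ι₁, V.posDef_of_ne⟩) Φ)).S.K₀.2.1)).K, ((HodgeCM.Level.capThree (V := V) (((sec42DataIdOf h isoOf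
          ⟨F.K⟩ ι₁ (⟨V.Hm, V.isHermitian, V.signature_ι₁, V.posDef_of_ne⟩) Φ)).S.K₀.1 : Subgroup ↥(HodgeCM.HermSpace3.adelicFin V)) ((sec42DataIdOf h isoOf ⟨F.K⟩ ι₁ (⟨V.Hm,
          V.isHermitian, V.signature_ι₁, V.posDef_of_ne⟩) Φ)).S.K₀.2.1)).isOpen_K, ((HodgeCM.Level.capThree (V := V) (((sec42DataIdOf h isoOf ⟨F.K⟩ ι₁ (⟨V.Hm, V.isHermitian,
          V.signature_ι₁, V.posDef_of_ne⟩) Φ)).S.K₀.1 : Subgroup ↥(HodgeCM.HermSpace3.adelicFin V)) ((sec42DataIdOf h isoOf ⟨F.K⟩ ι₁ (⟨V.Hm, V.isHermitian, V.signature_ι₁,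
          V.posDef_of_ne⟩) Φ)).S.K₀.2.1)).isCompact_K⟩

end Summit.HodgeConjecture.CorCM.D2Bridge.Iota1.Thm418CAtPin

end
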